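import Mathlib.Analysis.Calculus.ImplicitContDiff
import Mathlib.Analysis.Calculus.ContDiff.Deriv
import Mathlib.Analysis.Calculus.Deriv.Mul
import Mathlib.Analysis.Calculus.Deriv.Prod
import Mathlib.Analysis.Calculus.Deriv.Comp
import Mathlib.Algebra.MvPolynomial.PDeriv
import Mathlib.Algebra.Polynomial.Derivative
import Mathlib.Algebra.MvPolynomial.Nilpotent
import Mathlib.Algebra.MvPolynomial.NoZeroDivisors
import Mathlib.Topology.Algebra.Polynomial
import Literature.NumberTheory.DiophantineGeometry.PlaneCurveBezoutWeak
import Literature.NumberTheory.DiophantineGeometry.BombieriPilaSteps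
import Mathlib.Analysis.SpecialFunctions.Pow.Real
import HarnessLib

/-!
# Smooth branches of a real plane curve: the branch decomposition

Proof of the named fact `bombieriPila_curve_subset_branches` of `BombieriPilaSteps`
(`bombieriPila_curve_subset_branches_holds`), the second ingredient of the proof of Theorem 5
of [BombieriPila1989]: the real points in `[-N, N]²` of an absolutely irreducible curve `F = 0`
of degree `d` lie on `≤ c(d)` smooth branches of slope `≤ 1` over the `x`- or the `y`-axis
(over open intervals of length `≤ 4N`) together with `≤ c(d)` exceptional points.

## Proof

* Calculus of polynomial functions (`contDiff_mvEval`, `hasDerivAt_eval_update`,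
  `fderiv_mvEval_apply`), the implicit function theorem in the form of Mathlib's
  `ContDiffAt.implicitFunction`, and implicit differentiation
  (`pderiv_add_deriv_mul_pderiv_eq_zero`).
* `local_branches`: near a fibre `F(x₀, ·)` with simple zeros and locally bounded zeros, the
  zero set is the union of the graphs of the implicit functions (compactness excludes other
  zeros); `global_branches`: over an interval this gives finitely many global smooth branches
  (the number of zeros is locally constant, hence constant).
* The bad abscissae `badSet F` (roots of the leading coefficient in `y`, abscissae of zeros with
  `F_y = 0` or slope `±1`) are finite, `≤ d + 3(2d)⁴` of them (weak Bézout,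
  `PlaneCurveBezoutWeak`); off them the hypotheses of `global_branches` hold
  (`simple_of_not_mem_badSet`, `bound_of_not_mem_badSet` via the root bound `abs_le_of_isRoot`),
  and each branch has slope `≤ 1` throughout or `|F_y| < |F_x|` along it (`branch_slope`).
* `xPieces` assembles the pieces over the `x`-axis between consecutive bad abscissae; applying it
  to `F` and to `F` with swapped variables and observing that a zero on no piece would satisfy
  both `|F_y| < |F_x|` and `|F_x| < |F_y|` gives the decomposition, the exceptional set being the
  (finite) fibres over the bad abscissae and ordinates.

## References

* E. Bombieri, J. Pila, *The number of integral points on arcs and ovals*, Duke Math. J. 59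
  (1989) 337–357, proof of Theorem 5 [BombieriPila1989].
-/

namespace Literature.NumberTheory.DiophantineGeometry.Dioph

open scoped ContDiff Topology
open MvPolynomial Filter

/-! ### Calculus of polynomial functions of two real variables -/

section Calculus

variable (F : MvPolynomial (Fin 2) ℝ)

/-- A polynomial function of two real variables is smooth. [folklore] -/
theorem contDiff_mvEval :
    ContDiff ℝ ∞ (fun z : ℝ × ℝ => MvPolynomial.eval ![z.1, z.2] F) := by
  induction F using MvPolynomial.induction_on with
  | C a => simpa using contDiff_const
  | add p q hp hq => simpa [map_add] using hp.add hq
  | mul_X p i hp =>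
    fin_cases i
    · simpa using hp.mul contDiff_fst
    · simpa using hp.mul contDiff_snd

/-- Partial derivatives of a polynomial function: the derivative in the `i`-th variable is the
evaluation of `pderiv i`. [folklore] -/
theorem hasDerivAt_eval_update (g : Fin 2 → ℝ) (i : Fin 2) :
    HasDerivAt (fun t => MvPolynomial.eval (Function.update g i t) F)
      (MvPolynomial.eval g (pderiv i F)) (g i) := by
  induction F using MvPolynomial.induction_on with
  | C a =>
    simp only [eval_C, pderiv_C, map_zero]
    exact hasDerivAt_const (g i) a
  | add p q hp hq =>
    simp only [map_add]
    exact hp.add hq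
  | mul_X p j hp =>
    have h2 : HasDerivAt (fun t => Function.update g i t j) (if j = i then 1 else 0) (g i) := by
      by_cases hji : j = i
      · subst hji
        simp only [Function.update_self, if_true]
        exact hasDerivAt_id' (g j)
      · simp only [Function.update_of_ne hji, hji, if_false]
        exact hasDerivAt_const (g i) (g j)
    have h3 := hp.mul h2
    rw [Function.update_eq_self] at h3
    simp only [map_mul, eval_X]
    refine h3.congr_deriv ?_
    rw [pderiv_mul, map_add, map_mul, map_mul, eval_X, pderiv_X]
    congr 1
    simp only [Pi.single_apply]
    split_ifs <;> simp

/-- The partial derivative in `x`. [folklore] -/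
theorem hasDerivAt_eval_fst (x y : ℝ) :
    HasDerivAt (fun t => MvPolynomial.eval ![t, y] F) (MvPolynomial.eval ![x, y] (pderiv 0 F))
      x := by
  have h : ∀ t, Function.update ![x, y] 0 t = ![t, y] := fun t => by
    funext k; fin_cases k <;> simp
  simpa [h] using hasDerivAt_eval_update F ![x, y] 0

/-- The partial derivative in `y`. [folklore] -/
theorem hasDerivAt_eval_snd (x y : ℝ) :
    HasDerivAt (fun t => MvPolynomial.eval ![x, t] F) (MvPolynomial.eval ![x, y] (pderiv 1 F))
      y := by
  have h : ∀ t, Function.update ![x, y] 1 t = ![x, t] := fun t => by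
    funext k; fin_cases k <;> simp
  simpa [h] using hasDerivAt_eval_update F ![x, y] 1

/-- The Fréchet derivative of the polynomial function on the two axes. [folklore] -/
theorem fderiv_mvEval_apply (x y a b : ℝ) :
    fderiv ℝ (fun z : ℝ × ℝ => MvPolynomial.eval ![z.1, z.2] F) (x, y) (a, b) =
      a * MvPolynomial.eval ![x, y] (pderiv 0 F) + b * MvPolynomial.eval ![x, y] (pderiv 1 F) := by
  set f := fun z : ℝ × ℝ => MvPolynomial.eval ![z.1, z.2] F with hf
  have hd : DifferentiableAt ℝ f (x, y) :=
    (contDiff_mvEval F).contDiffAt.differentiableAt (by simp)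
  have h1 : fderiv ℝ f (x, y) (1, 0) = MvPolynomial.eval ![x, y] (pderiv 0 F) := by
    have hc : HasDerivAt (f ∘ fun t : ℝ => (t, y)) (fderiv ℝ f (x, y) (1, 0)) x :=
      hd.hasFDerivAt.comp_hasDerivAt x ((hasDerivAt_id' x).prodMk (hasDerivAt_const x y))
    exact hc.unique (hasDerivAt_eval_fst F x y)
  have h2 : fderiv ℝ f (x, y) (0, 1) = MvPolynomial.eval ![x, y] (pderiv 1 F) := by
    have hc : HasDerivAt (f ∘ fun t : ℝ => (x, t)) (fderiv ℝ f (x, y) (0, 1)) y :=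
      hd.hasFDerivAt.comp_hasDerivAt y ((hasDerivAt_const y x).prodMk (hasDerivAt_id' y))
    exact hc.unique (hasDerivAt_eval_snd F x y)
  have : ((a, b) : ℝ × ℝ) = a • (1, 0) + b • (0, 1) := by simp
  rw [this, map_add, map_smul, map_smul, h1, h2, smul_eq_mul, smul_eq_mul]

end Calculus

/-! ### Local structure of the zero set near a fibre with simple zeros -/

section Local

variable (F : MvPolynomial (Fin 2) ℝ)

/-- If `∂F/∂y (x, y) ≠ 0` then the `y`-derivative of the polynomial function at `(x, y)` is
invertible, as required by the implicit function theorem. [folklore] -/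
theorem isInvertible_fderiv_comp_inr {x y : ℝ}
    (h : MvPolynomial.eval ![x, y] (pderiv 1 F) ≠ 0) :
    (fderiv ℝ (fun z : ℝ × ℝ => MvPolynomial.eval ![z.1, z.2] F) (x, y) ∘L
      ContinuousLinearMap.inr ℝ ℝ ℝ).IsInvertible := by
  refine ⟨ContinuousLinearEquiv.unitsEquivAut ℝ (Units.mk0 _ h), ?_⟩
  apply ContinuousLinearMap.ext_ring
  simp [ContinuousLinearEquiv.unitsEquivAut_apply, fderiv_mvEval_apply]

/-- **Implicit differentiation.** If `Y` is differentiable at `x` and `F(t, Y(t)) = 0` for `t`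
near `x`, then `F_x + Y'(x) F_y = 0` at `(x, Y(x))`. [folklore] -/
theorem pderiv_add_deriv_mul_pderiv_eq_zero {Y : ℝ → ℝ} {Y' x : ℝ} (hY : HasDerivAt Y Y' x)
    (h0 : ∀ᶠ t in 𝓝 x, MvPolynomial.eval ![t, Y t] F = 0) :
    MvPolynomial.eval ![x, Y x] (pderiv 0 F) +
      Y' * MvPolynomial.eval ![x, Y x] (pderiv 1 F) = 0 := by
  set f := fun z : ℝ × ℝ => MvPolynomial.eval ![z.1, z.2] F with hf
  have hd : DifferentiableAt ℝ f (x, Y x) :=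
    (contDiff_mvEval F).contDiffAt.differentiableAt (by simp)
  have hc : HasDerivAt (f ∘ fun t => (t, Y t)) (fderiv ℝ f (x, Y x) (1, Y')) x :=
    hd.hasFDerivAt.comp_hasDerivAt x ((hasDerivAt_id' x).prodMk hY)
  have hz : HasDerivAt (f ∘ fun t => (t, Y t)) 0 x :=
    (hasDerivAt_const x (0 : ℝ)).congr_of_eventuallyEq
      (by filter_upwards [h0] with t ht; exact ht)
  have := hc.unique hz
  rw [fderiv_mvEval_apply, one_mul] at this
  exact this

/-- **Local structure of the real zero set.** Suppose the zeros of `F(x₀, ·)` are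
`e 0 < ⋯ < e (r-1)`, all simple (`∂F/∂y ≠ 0` there), and the zeros of `F(x, ·)` stay bounded for
`x` near `x₀`. Then there are functions `φ i`, smooth at `x₀`, with `φ i x₀ = e i`, such that
for `x` near `x₀` the zeros of `F(x, ·)` are exactly `φ 0 x < ⋯ < φ (r-1) x` (implicit function
theorem at each zero, plus a compactness argument excluding other zeros). [folklore] -/
theorem local_branches {x₀ : ℝ} {r : ℕ} {e : Fin r → ℝ} (he : StrictMono e)
    (hzero : ∀ y, MvPolynomial.eval ![x₀, y] F = 0 ↔ y ∈ Set.range e)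
    (hsimple : ∀ i, MvPolynomial.eval ![x₀, e i] (pderiv 1 F) ≠ 0)
    {R : ℝ} (hbound : ∀ᶠ x in 𝓝 x₀, ∀ y, MvPolynomial.eval ![x, y] F = 0 → |y| ≤ R) :
    ∃ φ : Fin r → ℝ → ℝ, (∀ i, φ i x₀ = e i) ∧ (∀ i, ContDiffAt ℝ ∞ (φ i) x₀) ∧
      ∀ᶠ x in 𝓝 x₀, StrictMono (fun i => φ i x) ∧
        ∀ y, MvPolynomial.eval ![x, y] F = 0 ↔ ∃ i, φ i x = y := by
  set f := fun z : ℝ × ℝ => MvPolynomial.eval ![z.1, z.2] F with hf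
  have hfc : Continuous f := (contDiff_mvEval F).continuous
  have hn : (∞ : ℕ∞ω) ≠ 0 := by simp
  have cdf : ∀ i, ContDiffAt ℝ ∞ f (x₀, e i) := fun i => (contDiff_mvEval F).contDiffAt
  have hinv : ∀ i, (fderiv ℝ f (x₀, e i) ∘L ContinuousLinearMap.inr ℝ ℝ ℝ).IsInvertible :=
    fun i => isInvertible_fderiv_comp_inr F (hsimple i)
  set ψ : Fin r → ℝ → ℝ := fun i => (cdf i).implicitFunction hn (hinv i) with hψ
  have hψ0 : ∀ i, ψ i x₀ = e i := fun i => (cdf i).implicitFunction_apply_self hn (hinv i)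
  have hψs : ∀ i, ContDiffAt ℝ ∞ (ψ i) x₀ :=
    fun i => (cdf i).contDiffAt_implicitFunction hn (hinv i)
  have hfe : ∀ i, f (x₀, e i) = 0 := fun i => (hzero (e i)).2 ⟨i, rfl⟩
  -- product neighbourhoods on which the zero set is the graph of `ψ i`
  have hbox : ∀ i, ∃ ε > 0, ∀ x y, |x - x₀| < ε → |y - e i| < ε →
      (f (x, y) = 0 ↔ ψ i x = y) := by
    intro i
    have h := (cdf i).eventually_apply_eq_iff_implicitFunction hn (hinv i)
    rw [hfe i] at h
    obtain ⟨ε, hε, hball⟩ := Metric.eventually_nhds_iff.1 h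
    refine ⟨ε, hε, fun x y hx hy => @hball (x, y) ?_⟩
    rw [Prod.dist_eq, Real.dist_eq, Real.dist_eq]
    exact max_lt hx hy
  choose ε hε hbox using hbox
  -- a common small `ε₀`, also separating the zeros `e i`
  obtain ⟨ε₀, hε₀, hε₀ε, hε₀gap⟩ : ∃ ε₀ : ℝ, 0 < ε₀ ∧ (∀ i, ε₀ ≤ ε i) ∧
      ∀ i j, i < j → e i + ε₀ < e j - ε₀ := by
    have h1 : ∀ᶠ t in 𝓝[>] (0 : ℝ), 0 < t := eventually_mem_nhdsWithin
    have h2 : ∀ᶠ t in 𝓝[>] (0 : ℝ), ∀ i, t ≤ ε i :=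
      eventually_all.2 fun i => mem_nhdsWithin_of_mem_nhds (Iic_mem_nhds (hε i))
    have h3 : ∀ᶠ t in 𝓝[>] (0 : ℝ), ∀ i j, i < j → e i + t < e j - t := by
      refine eventually_all.2 fun i => eventually_all.2 fun j => ?_
      by_cases hij : i < j
      · have hgap : 0 < (e j - e i) / 2 := by linarith [he hij]
        refine mem_nhdsWithin_of_mem_nhds ?_
        filter_upwards [Iio_mem_nhds hgap] with t ht
        intro _
        rw [Set.mem_Iio] at ht
        linarith
      · exact Eventually.of_forall fun t h => absurd h hij
    obtain ⟨t, ht1, ht2, ht3⟩ := (h1.and (h2.and h3)).exists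
    exact ⟨t, ht1, ht2, ht3⟩
  -- compactness: for `x` near `x₀` every zero of `F(x, ·)` is `ε₀`-close to some `e i`
  have hclose : ∀ᶠ x in 𝓝 x₀, ∀ y, f (x, y) = 0 → ∃ i, |y - e i| < ε₀ := by
    obtain ⟨δ₁, hδ₁, hR⟩ := Metric.eventually_nhds_iff.1 hbound
    by_contra hcon
    set K : Set (ℝ × ℝ) := {v | |v.1 - x₀| ≤ δ₁ / 2} ∩ ({v | |v.2| ≤ R} ∩ ({v | f v = 0} ∩
      ⋂ i, {v : ℝ × ℝ | ε₀ ≤ |v.2 - e i|})) with hK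
    have hKc : IsCompact K := by
      have hbig : IsCompact (Set.Icc (x₀ - δ₁ / 2) (x₀ + δ₁ / 2) ×ˢ Set.Icc (-R) R) :=
        isCompact_Icc.prod isCompact_Icc
      refine hbig.of_isClosed_subset ?_ ?_
      · refine IsClosed.inter ?_ (IsClosed.inter ?_ (IsClosed.inter ?_ (isClosed_iInter ?_)))
        · exact isClosed_le (by fun_prop) continuous_const
        · exact isClosed_le (by fun_prop) continuous_const
        · exact isClosed_eq hfc continuous_const
        · exact fun i => isClosed_le continuous_const (by fun_prop)
      · rintro ⟨x, y⟩ ⟨hx, hy, -, -⟩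
        simp only [Set.mem_setOf_eq, abs_le] at hx hy
        exact ⟨⟨by linarith, by linarith⟩, ⟨by linarith, by linarith⟩⟩
    have hPc : IsClosed (Prod.fst '' K) := (hKc.image continuous_fst).isClosed
    have hx₀ : x₀ ∈ closure (Prod.fst '' K) := by
      rw [Metric.mem_closure_iff]
      intro δ hδ
      have hfr : ∃ᶠ x in 𝓝 x₀, ¬ ∀ y, f (x, y) = 0 → ∃ i, |y - e i| < ε₀ :=
        not_eventually.1 hcon
      have hnear : ∀ᶠ x in 𝓝 x₀, dist x x₀ < min δ (δ₁ / 2) :=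
        Metric.ball_mem_nhds x₀ (lt_min hδ (half_pos hδ₁))
      obtain ⟨x, hxbad, hxd⟩ := (hfr.and_eventually hnear).exists
      push Not at hxbad
      obtain ⟨y, hy0, hfar⟩ := hxbad
      have hxK : (x, y) ∈ K := by
        refine ⟨?_, ?_, hy0, ?_⟩
        · simp only [Set.mem_setOf_eq]
          rw [Real.dist_eq] at hxd
          exact (hxd.trans_le (min_le_right _ _)).le
        · exact hR (hxd.trans_le ((min_le_right _ _).trans (half_le_self hδ₁.le))) y hy0
        · exact Set.mem_iInter.2 hfar
      refine ⟨x, ⟨(x, y), hxK, rfl⟩, ?_⟩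
      rw [dist_comm]; exact hxd.trans_le (min_le_left _ _)
    rw [hPc.closure_eq] at hx₀
    obtain ⟨⟨x, y⟩, ⟨-, -, hfy, hfar⟩, hxx⟩ := hx₀
    simp only at hxx
    subst hxx
    obtain ⟨i, rfl⟩ := (hzero y).1 hfy
    have := Set.mem_iInter.1 hfar i
    simp only [Set.mem_setOf_eq, sub_self, abs_zero] at this
    exact absurd this (not_le.2 hε₀)
  -- continuity of the implicit functions at `x₀`
  have hψc : ∀ᶠ x in 𝓝 x₀, ∀ i, |ψ i x - e i| < ε₀ := by
    refine eventually_all.2 fun i => ?_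
    have := (hψs i).continuousAt.eventually (Metric.ball_mem_nhds (ψ i x₀) hε₀)
    filter_upwards [this] with x hx
    rwa [Real.dist_eq, hψ0 i] at hx
  have hxε : ∀ᶠ x in 𝓝 x₀, |x - x₀| < ε₀ := by
    filter_upwards [Metric.ball_mem_nhds x₀ hε₀] with x hx
    rwa [Metric.mem_ball, Real.dist_eq] at hx
  refine ⟨ψ, hψ0, hψs, ?_⟩
  filter_upwards [hclose, hψc, hxε] with x hcl hc hx
  refine ⟨fun i j hij => ?_, fun y => ⟨fun hy => ?_, ?_⟩⟩
  · have hi := hc i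
    have hj := hc j
    have := hε₀gap i j hij
    rw [abs_lt] at hi hj
    linarith
  · obtain ⟨i, hi⟩ := hcl y hy
    exact ⟨i, (hbox i x y (hx.trans_le (hε₀ε i)) (hi.trans_le (hε₀ε i))).1 hy⟩
  · rintro ⟨i, rfl⟩
    exact (hbox i x (ψ i x) (hx.trans_le (hε₀ε i)) ((hc i).trans_le (hε₀ε i))).2 rfl

end Local

/-! ### Global branches over an interval -/

section Global

variable (F : MvPolynomial (Fin 2) ℝ)

/-- **Global smooth branches.** On an open interval `(a, b)` over which all zeros of
`F(x, ·)` are simple and locally bounded, the real zero set of `F` is the disjoint union of the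
graphs of finitely many smooth functions `Y 0 < Y 1 < ⋯ < Y (r-1)` on `(a, b)`: the number of
zeros is locally constant (by `local_branches`), hence constant on the connected interval, and
the `i`-th smallest zero is locally one of the implicit functions, hence smooth. [folklore] -/
theorem global_branches {a b : ℝ} (hab : a < b)
    (hfin : ∀ x ∈ Set.Ioo a b, {y | MvPolynomial.eval ![x, y] F = 0}.Finite)
    (hsimple : ∀ x ∈ Set.Ioo a b, ∀ y, MvPolynomial.eval ![x, y] F = 0 →
      MvPolynomial.eval ![x, y] (pderiv 1 F) ≠ 0)
    (hbound : ∀ x₀ ∈ Set.Ioo a b, ∃ R : ℝ, ∀ᶠ x in 𝓝 x₀, ∀ y,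
      MvPolynomial.eval ![x, y] F = 0 → |y| ≤ R) :
    ∃ (r : ℕ) (Y : Fin r → ℝ → ℝ),
      (∀ i, ContDiffOn ℝ ∞ (Y i) (Set.Ioo a b)) ∧
      (∀ x ∈ Set.Ioo a b, StrictMono fun i => Y i x) ∧
      (∀ x ∈ Set.Ioo a b, ∀ y, MvPolynomial.eval ![x, y] F = 0 ↔ ∃ i, Y i x = y) := by
  classical
  -- the fibres as finsets
  set Z : ℝ → Finset ℝ := fun x =>
    if hx : x ∈ Set.Ioo a b then (hfin x hx).toFinset else ∅ with hZ
  have hZmem : ∀ x ∈ Set.Ioo a b, ∀ y, y ∈ Z x ↔ MvPolynomial.eval ![x, y] F = 0 := by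
    intro x hx y
    simp only [hZ, dif_pos hx, Set.Finite.mem_toFinset, Set.mem_setOf_eq]
  -- local structure at each point, phrased with `Z`
  have hloc : ∀ x₀ ∈ Set.Ioo a b, ∃ φ : Fin (Z x₀).card → ℝ → ℝ,
      (∀ i, φ i x₀ = (Z x₀).orderEmbOfFin rfl i) ∧ (∀ i, ContDiffAt ℝ ∞ (φ i) x₀) ∧
      ∀ᶠ x in 𝓝 x₀, x ∈ Set.Ioo a b ∧ StrictMono (fun i => φ i x) ∧
        ∀ y, MvPolynomial.eval ![x, y] F = 0 ↔ ∃ i, φ i x = y := by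
    intro x₀ hx₀
    obtain ⟨R, hR⟩ := hbound x₀ hx₀
    have he : StrictMono ((Z x₀).orderEmbOfFin rfl) := OrderEmbedding.strictMono _
    have hzero : ∀ y, MvPolynomial.eval ![x₀, y] F = 0 ↔
        y ∈ Set.range ((Z x₀).orderEmbOfFin rfl) := by
      intro y
      rw [Finset.range_orderEmbOfFin, Finset.mem_coe, hZmem x₀ hx₀]
    have hsimple' : ∀ i, MvPolynomial.eval ![x₀, (Z x₀).orderEmbOfFin rfl i] (pderiv 1 F) ≠ 0 :=
      fun i => hsimple x₀ hx₀ _ ((hzero _).2 ⟨i, rfl⟩)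
    obtain ⟨φ, h0, hs, hev⟩ := local_branches F he hzero hsimple' hR
    refine ⟨φ, h0, hs, ?_⟩
    filter_upwards [hev, Ioo_mem_nhds hx₀.1 hx₀.2] with x hx hxJ
    exact ⟨hxJ, hx⟩
  -- the number of zeros is locally constant, hence constant
  have hcard_loc : ∀ x₀ ∈ Set.Ioo a b, ∀ᶠ x in 𝓝 x₀, (Z x).card = (Z x₀).card := by
    intro x₀ hx₀
    obtain ⟨φ, -, -, hev⟩ := hloc x₀ hx₀
    filter_upwards [hev] with x ⟨hxJ, hmono, hzer⟩
    have : Z x = Finset.univ.image (fun i => φ i x) := by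
      ext y
      rw [hZmem x hxJ, hzer y, Finset.mem_image]
      simp
    rw [this, Finset.card_image_of_injective _ hmono.injective, Finset.card_univ,
      Fintype.card_fin]
  have hcard : ∀ x ∈ Set.Ioo a b, ∀ x' ∈ Set.Ioo a b, (Z x).card = (Z x').card := by
    have hcont : ContinuousOn (fun x => (Z x).card) (Set.Ioo a b) := by
      intro x hx
      have h : (fun _ => (Z x).card) =ᶠ[𝓝 x] fun x' => (Z x').card := by
        filter_upwards [hcard_loc x hx] with x' hx'
        exact hx'.symm
      exact ((continuousAt_congr h).1 continuousAt_const).continuousWithinAt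
    intro x hx x' hx'
    exact isPreconnected_Ioo.constant hcont hx hx'
  -- fix the number of branches
  have hxcJ : (a + b) / 2 ∈ Set.Ioo a b := ⟨by linarith, by linarith⟩
  set r := (Z ((a + b) / 2)).card with hr
  have hcardr : ∀ x ∈ Set.Ioo a b, (Z x).card = r := fun x hx => hcard x hx _ hxcJ
  -- the branches: the sorted enumeration of the fibre
  set Y : Fin r → ℝ → ℝ := fun i x =>
    if hx : x ∈ Set.Ioo a b then (Z x).orderEmbOfFin (hcardr x hx) i else 0 with hY
  have hYmono : ∀ x ∈ Set.Ioo a b, StrictMono fun i => Y i x := by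
    intro x hx i j hij
    simp only [hY, dif_pos hx]
    exact (OrderEmbedding.strictMono _) hij
  have hYzero : ∀ x ∈ Set.Ioo a b, ∀ y, MvPolynomial.eval ![x, y] F = 0 ↔ ∃ i, Y i x = y := by
    intro x hx y
    rw [← hZmem x hx, ← Finset.mem_coe, ← Finset.range_orderEmbOfFin (Z x) (hcardr x hx),
      Set.mem_range]
    simp only [hY, dif_pos hx]
  refine ⟨r, Y, ?_, hYmono, hYzero⟩
  -- smoothness
  intro i x₀ hx₀
  suffices h : ContDiffAt ℝ ∞ (Y i) x₀ from h.contDiffWithinAt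
  obtain ⟨φ, h0, hs, hev⟩ := hloc x₀ hx₀
  have hrr : (Z x₀).card = r := hcardr x₀ hx₀
  have heq : ∀ᶠ x in 𝓝 x₀, Y i x = φ (Fin.cast hrr.symm i) x := by
    filter_upwards [hev] with x ⟨hxJ, hmono, hzer⟩
    have h1 : (fun j : Fin r => φ (Fin.cast hrr.symm j) x) =
        (Z x).orderEmbOfFin (hcardr x hxJ) := by
      apply Finset.orderEmbOfFin_unique
      · intro j
        rw [hZmem x hxJ, hzer]
        exact ⟨_, rfl⟩
      · intro j j' hjj'
        exact hmono hjj'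
    have := congrFun h1 i
    simp only [hY, dif_pos hxJ]
    exact this.symm
  exact (hs (Fin.cast hrr.symm i)).congr_of_eventuallyEq heq

end Global

/-! ### Slopes of branches -/

section Slopes

/-- **Slope dichotomy.** A smooth function on an open interval whose derivative never equals
`±1` has slope `≤ 1` in absolute value throughout or `> 1` throughout (intermediate value
theorem for the continuous derivative). [folklore] -/
theorem slope_dichotomy {Y : ℝ → ℝ} {a b : ℝ} (hY : ContDiffOn ℝ ∞ Y (Set.Ioo a b))
    (h1 : ∀ x ∈ Set.Ioo a b, deriv Y x ≠ 1) (h2 : ∀ x ∈ Set.Ioo a b, deriv Y x ≠ -1) :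
    (∀ x ∈ Set.Ioo a b, |deriv Y x| ≤ 1) ∨ (∀ x ∈ Set.Ioo a b, 1 < |deriv Y x|) := by
  have hcont : ContinuousOn (deriv Y) (Set.Ioo a b) :=
    hY.continuousOn_deriv_of_isOpen isOpen_Ioo (by simp)
  by_contra h
  rw [not_or] at h
  obtain ⟨h₁, h₂⟩ := h
  push Not at h₁ h₂
  obtain ⟨x₁, hx₁, hgt⟩ := h₁
  obtain ⟨x₂, hx₂, hle⟩ := h₂
  have hlt : |deriv Y x₂| < 1 := by
    refine lt_of_le_of_ne hle fun h => ?_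
    rcases abs_eq (zero_le_one) |>.1 h with h' | h'
    · exact h1 x₂ hx₂ h'
    · exact h2 x₂ hx₂ h'
  rw [abs_lt] at hlt
  rcases lt_abs.1 hgt with hpos | hneg
  · have h1mem : (1 : ℝ) ∈ Set.Icc (deriv Y x₂) (deriv Y x₁) := ⟨hlt.2.le, hpos.le⟩
    obtain ⟨x, hx, hx1⟩ := isPreconnected_Ioo.intermediate_value hx₂ hx₁ hcont h1mem
    exact h1 x hx hx1
  · have h1mem : (-1 : ℝ) ∈ Set.Icc (deriv Y x₁) (deriv Y x₂) := ⟨by linarith, hlt.1.le⟩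
    obtain ⟨x, hx, hx1⟩ := isPreconnected_Ioo.intermediate_value hx₁ hx₂ hcont h1mem
    exact h2 x hx hx1

end Slopes

/-! ### Root bounds -/

section RootBound

open Polynomial

/-- A Cauchy-type bound: a real root `y` of a nonzero polynomial satisfies
`|y| ≤ max 1 (∑_{i < deg} |aᵢ| / |a_deg|)`. [folklore] -/
theorem abs_le_of_isRoot (p : ℝ[X]) (hp : p ≠ 0) {y : ℝ} (hy : p.IsRoot y) :
    |y| ≤ max 1 ((∑ i ∈ Finset.range p.natDegree, |p.coeff i|) / |p.leadingCoeff|) := by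
  rcases le_or_gt |y| 1 with h | h
  · exact h.trans (le_max_left _ _)
  refine le_trans ?_ (le_max_right _ _)
  have hlc : 0 < |p.leadingCoeff| := abs_pos.2 (leadingCoeff_ne_zero.2 hp)
  rw [le_div_iff₀ hlc]
  have hm : p.natDegree ≠ 0 := by
    intro hm
    rw [eq_C_of_natDegree_eq_zero hm, IsRoot.def, Polynomial.eval_C] at hy
    apply hp
    rw [eq_C_of_natDegree_eq_zero hm, hy, map_zero]
  set m := p.natDegree with hmdef
  have hsum : p.leadingCoeff * y ^ m = -∑ i ∈ Finset.range m, p.coeff i * y ^ i := by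
    have h0 := hy
    rw [IsRoot.def, eval_eq_sum_range, Finset.sum_range_succ] at h0
    rw [Polynomial.leadingCoeff]
    linarith
  have hy1 : 1 ≤ |y| := h.le
  have key : |p.leadingCoeff| * |y| ^ m ≤
      (∑ i ∈ Finset.range m, |p.coeff i|) * |y| ^ (m - 1) := by
    calc |p.leadingCoeff| * |y| ^ m = |p.leadingCoeff * y ^ m| := by rw [abs_mul, abs_pow]
      _ = |∑ i ∈ Finset.range m, p.coeff i * y ^ i| := by rw [hsum, abs_neg]
      _ ≤ ∑ i ∈ Finset.range m, |p.coeff i * y ^ i| := Finset.abs_sum_le_sum_abs _ _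
      _ ≤ ∑ i ∈ Finset.range m, |p.coeff i| * |y| ^ (m - 1) := by
          refine Finset.sum_le_sum fun i hi => ?_
          rw [abs_mul, abs_pow]
          refine mul_le_mul_of_nonneg_left ?_ (abs_nonneg _)
          exact pow_le_pow_right₀ hy1 (by have := Finset.mem_range.1 hi; omega)
      _ = (∑ i ∈ Finset.range m, |p.coeff i|) * |y| ^ (m - 1) := by rw [Finset.sum_mul]
  have hpow : |y| ^ m = |y| * |y| ^ (m - 1) := by
    rw [← pow_succ']
    congr 1
    omega
  rw [hpow] at key
  have hpos : 0 < |y| ^ (m - 1) := pow_pos (by linarith) _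
  refine le_of_mul_le_mul_right ?_ hpos
  calc |y| * |p.leadingCoeff| * |y| ^ (m - 1) = |p.leadingCoeff| * (|y| * |y| ^ (m - 1)) := by
        ring
    _ ≤ (∑ i ∈ Finset.range m, |p.coeff i|) * |y| ^ (m - 1) := key

/-- **Local uniform root bound** for the fibres of `P ∈ ℝ[x][y]`: if the leading coefficient
does not vanish at `x₀` then the real roots of `P(x, ·)` are uniformly bounded for `x` near `x₀`.
[folklore] -/
theorem fibre_root_bound (P : ℝ[X][X]) {x₀ : ℝ} (ha : P.leadingCoeff.eval x₀ ≠ 0) :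
    ∃ R : ℝ, ∀ᶠ x in 𝓝 x₀, ∀ y, P.evalEval x y = 0 → |y| ≤ R := by
  set m := P.natDegree with hm
  set S : ℝ → ℝ := fun x => ∑ i ∈ Finset.range m, |(P.coeff i).eval x| with hS
  have hSc : Continuous S := by
    refine continuous_finsetSum _ fun i _ => ?_
    exact continuous_abs.comp (P.coeff i).continuous
  set α := |P.leadingCoeff.eval x₀| / 2 with hα
  have hα0 : 0 < α := by positivity
  have hev1 : ∀ᶠ x in 𝓝 x₀, α < |P.leadingCoeff.eval x| := by
    refine ContinuousAt.eventually_lt continuousAt_const ?_ (by rw [hα]; linarith [abs_pos.2 ha])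
    exact (continuous_abs.comp P.leadingCoeff.continuous).continuousAt
  have hev2 : ∀ᶠ x in 𝓝 x₀, S x < S x₀ + 1 :=
    ContinuousAt.eventually_lt hSc.continuousAt continuousAt_const (by linarith)
  refine ⟨max 1 ((S x₀ + 1) / α), ?_⟩
  filter_upwards [hev1, hev2] with x hx1 hx2 y hy
  have hax : P.leadingCoeff.eval x ≠ 0 := fun h => by rw [h, abs_zero] at hx1; linarith
  set px := P.map (evalRingHom x) with hpx
  have hlead : (evalRingHom x) P.leadingCoeff ≠ 0 := hax
  have hdeg : px.natDegree = m := natDegree_map_of_leadingCoeff_ne_zero _ hlead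
  have hlc : px.leadingCoeff = P.leadingCoeff.eval x :=
    leadingCoeff_map_of_leadingCoeff_ne_zero _ hlead
  have hpx0 : px ≠ 0 := fun h => by
    rw [h, leadingCoeff_zero] at hlc
    exact hax hlc.symm
  have hroot : px.IsRoot y := by
    rw [IsRoot.def, hpx, map_evalRingHom_eval]
    exact hy
  have hb := abs_le_of_isRoot px hpx0 hroot
  rw [hdeg, hlc] at hb
  have hcoeff : ∀ i, px.coeff i = (P.coeff i).eval x := fun i => by
    rw [hpx, Polynomial.coeff_map, coe_evalRingHom]
  simp only [hcoeff] at hb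
  refine hb.trans (max_le_max le_rfl ?_)
  have hS0 : 0 ≤ S x := Finset.sum_nonneg fun i _ => abs_nonneg _
  calc (∑ i ∈ Finset.range m, |(P.coeff i).eval x|) / |P.leadingCoeff.eval x|
      = S x / |P.leadingCoeff.eval x| := rfl
    _ ≤ (S x₀ + 1) / α := by
        rw [div_le_div_iff₀ (by linarith) hα0]
        nlinarith

end RootBound

/-! ### Algebra: `F` as a polynomial in `y` over `ℝ[x]` -/

section Algebra

open Polynomial Polynomial.Bivariate

variable (F : MvPolynomial (Fin 2) ℝ)

/-- `F` viewed as a polynomial in `y` with coefficients in `ℝ[x]`. [folklore] -/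
noncomputable abbrev toY : ℝ[X][X] := (equivMvPolynomial ℝ).symm F

/-- Evaluation through `toY`. [folklore] -/
theorem eval_eq_evalEval (x y : ℝ) : MvPolynomial.eval ![x, y] F = (toY F).evalEval x y := by
  rw [← eval_equivMvPolynomial, AlgEquiv.apply_symm_apply]

/-- The fibre polynomial `F(x, ·) ∈ ℝ[y]` evaluates to `F(x, y)`. [folklore] -/
theorem fibre_eval (x y : ℝ) :
    ((toY F).map (evalRingHom x)).eval y = MvPolynomial.eval ![x, y] F := by
  rw [map_evalRingHom_eval, eval_eq_evalEval]

/-- An absolutely irreducible real polynomial is irreducible over `ℝ` (units of `ℂ[x, y]` that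
come from `ℝ[x, y]` are units there). [folklore] -/
theorem irreducible_of_irreducible_map_complex {F : MvPolynomial (Fin 2) ℝ}
    (h : Irreducible (MvPolynomial.map (algebraMap ℝ ℂ) F)) : Irreducible F := by
  have hinj : Function.Injective (algebraMap ℝ ℂ) := (algebraMap ℝ ℂ).injective
  have hunit : ∀ G : MvPolynomial (Fin 2) ℝ, IsUnit (MvPolynomial.map (algebraMap ℝ ℂ) G) →
      IsUnit G := by
    intro G hG
    rw [MvPolynomial.isUnit_iff_eq_C_of_isReduced] at hG ⊢
    obtain ⟨r, hr, hGr⟩ := hG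
    have hdeg : G.totalDegree = 0 := by
      have : (MvPolynomial.map (algebraMap ℝ ℂ) G).totalDegree = G.totalDegree := by
        simp [MvPolynomial.totalDegree, MvPolynomial.support_map_of_injective G hinj]
      rw [← this, hGr, totalDegree_C]
    rw [totalDegree_eq_zero_iff_eq_C] at hdeg
    refine ⟨G.coeff 0, ?_, hdeg⟩
    rw [hdeg, MvPolynomial.map_C] at hGr
    have hc : algebraMap ℝ ℂ (G.coeff 0) = r := MvPolynomial.C_injective _ _ hGr
    have h0 : G.coeff 0 ≠ 0 := by
      rintro h0
      rw [h0, map_zero] at hc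
      exact hr.ne_zero hc.symm
    exact isUnit_iff_ne_zero.2 h0
  refine ⟨fun hu => h.not_isUnit (hu.map _), fun a b hab => ?_⟩
  have := h.isUnit_or_isUnit (by rw [hab, map_mul])
  exact this.imp (hunit a) (hunit b)

variable {F}

/-- No fibre polynomial `F(x, ·)` vanishes identically when `F` is irreducible of degree `≥ 2`
(otherwise `x - x₀` would divide `F`). [folklore] -/
theorem fibre_ne_zero (hF : Irreducible F) (hd : 2 ≤ F.totalDegree) (x : ℝ) :
    (toY F).map (evalRingHom x) ≠ 0 := by
  intro h0
  have hdvd : Polynomial.C (Polynomial.X - Polynomial.C x) ∣ toY F := by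
    rw [Polynomial.C_dvd_iff_dvd_coeff]
    intro i
    rw [dvd_iff_isRoot, IsRoot.def]
    have := congrArg (fun q => q.coeff i) h0
    simpa [Polynomial.coeff_map] using this
  have hirr : Irreducible (toY F) := (MulEquiv.irreducible_iff (equivMvPolynomial ℝ).symm).2 hF
  obtain ⟨w, hw⟩ := hdvd
  rcases hirr.isUnit_or_isUnit hw with hu | hu
  · rw [Polynomial.isUnit_C] at hu
    exact not_isUnit_X_sub_C x hu
  · obtain ⟨w₁, hw₁, rfl⟩ := Polynomial.isUnit_iff.1 hu
    obtain ⟨c, -, rfl⟩ := Polynomial.isUnit_iff.1 hw₁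
    have hF' : F = (MvPolynomial.X (0 : Fin 2) - MvPolynomial.C x) * MvPolynomial.C c := by
      have := congrArg (equivMvPolynomial ℝ) hw
      rwa [AlgEquiv.apply_symm_apply, map_mul, map_sub, map_sub, equivMvPolynomial_C_X,
        equivMvPolynomial_C_C, equivMvPolynomial_C_C] at this
    have : F.totalDegree ≤ 1 := by
      rw [hF']
      calc ((MvPolynomial.X (0 : Fin 2) - MvPolynomial.C x) * MvPolynomial.C c).totalDegree
          ≤ (MvPolynomial.X (R := ℝ) (0 : Fin 2) - MvPolynomial.C x).totalDegree +
            (MvPolynomial.C (σ := Fin 2) c).totalDegree := totalDegree_mul _ _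
        _ ≤ 1 + 0 := by
            refine add_le_add ((totalDegree_sub _ _).trans (max_le ?_ ?_)) (by simp)
            · rw [totalDegree_X]
            · simp
    omega

/-- Every fibre `{y : F(x, y) = 0}` is finite, with at most `deg F` elements. [folklore] -/
theorem fibre_finite (hF : Irreducible F) (hd : 2 ≤ F.totalDegree) (x : ℝ) :
    {y | MvPolynomial.eval ![x, y] F = 0}.Finite ∧
      {y | MvPolynomial.eval ![x, y] F = 0}.ncard ≤ F.totalDegree := by
  classical
  set px := (toY F).map (evalRingHom x) with hpxdef
  have hpx := fibre_ne_zero hF hd x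
  have hsub : {y | MvPolynomial.eval ![x, y] F = 0} = (px.roots.toFinset : Set ℝ) := by
    ext y
    simp only [Set.mem_setOf_eq, Finset.mem_coe, Multiset.mem_toFinset, mem_roots hpx,
      IsRoot.def, hpxdef, fibre_eval]
  rw [hsub]
  refine ⟨Finset.finite_toSet _, ?_⟩
  rw [Set.ncard_coe_finset]
  calc px.roots.toFinset.card ≤ px.natDegree := (Multiset.toFinset_card_le _).trans (card_roots' _)
    _ ≤ (toY F).natDegree := natDegree_map_le
    _ ≤ F.totalDegree := natDegree_symm_le F

/-- If `∂F/∂y = 0` identically then `F` (irreducible of degree `≥ 2`) has no real zeros at all.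
[folklore] -/
theorem eval_ne_zero_of_pderiv_eq_zero (hF : Irreducible F) (hd : 2 ≤ F.totalDegree)
    (h : pderiv 1 F = 0) (x y : ℝ) : MvPolynomial.eval ![x, y] F ≠ 0 := by
  have hder : derivative (toY F) = 0 := by
    apply (equivMvPolynomial ℝ).injective
    rw [← pderiv_one_equivMvPolynomial, AlgEquiv.apply_symm_apply, h, map_zero]
  have hdeg : (toY F).natDegree = 0 := Polynomial.derivative_eq_zero.1 hder
  intro h0
  have hpx := fibre_ne_zero hF hd x
  have h1 := fibre_eval F x y
  rw [eq_C_of_natDegree_eq_zero hdeg, Polynomial.map_C] at hpx h1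
  rw [Polynomial.eval_C, coe_evalRingHom, h0] at h1
  apply hpx
  rw [coe_evalRingHom, h1, map_zero]

variable (F) in
/-- The total degree drops under a nonzero partial derivative. [folklore] -/
theorem totalDegree_pderiv_lt {i : Fin 2} (h : pderiv i F ≠ 0) :
    (pderiv i F).totalDegree < F.totalDegree := by
  have hne : (pderiv i F).support.Nonempty := MvPolynomial.support_nonempty.2 h
  obtain ⟨m, hm, hmax⟩ :=
    Finset.exists_mem_eq_sup _ hne (fun s : Fin 2 →₀ ℕ => s.sum fun _ e => e)
  rw [MvPolynomial.totalDegree, hmax]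
  have hc : MvPolynomial.coeff m (pderiv i F) ≠ 0 := MvPolynomial.mem_support_iff.1 hm
  rw [coeff_pderiv] at hc
  have hc' : MvPolynomial.coeff (m + Finsupp.single i 1) F ≠ 0 := fun h0 => hc (by
    rw [h0, zero_mul])
  have hle := le_totalDegree (MvPolynomial.mem_support_iff.2 hc')
  rw [Finsupp.sum_add_index' (fun _ => rfl) (fun _ _ _ => rfl), Finsupp.sum_single_index rfl]
    at hle
  omega

/-- `F` does not divide its nonzero partial derivatives, nor nonzero combinations of them of
lower degree. [folklore] -/
theorem not_dvd_of_totalDegree_lt {G : MvPolynomial (Fin 2) ℝ} (hG : G ≠ 0)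
    (hlt : G.totalDegree < F.totalDegree) : ¬ F ∣ G := fun h =>
  absurd (MvPolynomial.totalDegree_le_of_dvd_of_isDomain h hG) (not_le.2 hlt)

variable (F) in
/-- Partial derivatives of the polynomial with swapped variables. [folklore] -/
theorem pderiv_rename_swap (i : Fin 2) :
    pderiv i (rename (Equiv.swap (0 : Fin 2) 1) F) =
      rename (Equiv.swap (0 : Fin 2) 1) (pderiv (Equiv.swap (0 : Fin 2) 1 i) F) := by
  have := pderiv_rename (Equiv.swap (0 : Fin 2) 1).injective (Equiv.swap (0 : Fin 2) 1 i) F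
  rwa [Equiv.swap_apply_self] at this

end Algebra

/-! ### The bad abscissae -/

section BadSet

open Polynomial Polynomial.Bivariate

variable (F : MvPolynomial (Fin 2) ℝ)

open scoped Classical in
/-- The `x`-coordinates of the common zeros of `F` and `G` (empty if `G = 0`). [folklore] -/
noncomputable def badX (G : MvPolynomial (Fin 2) ℝ) : Set ℝ :=
  if G = 0 then ∅ else
    Prod.fst '' {p : ℝ × ℝ | MvPolynomial.eval ![p.1, p.2] F = 0 ∧ MvPolynomial.eval ![p.1, p.2] G
      = 0}

variable {F}

/-- `badX F G` is finite, with a bound polynomial in the degrees (weak Bézout). [folklore] -/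
theorem badX_finite (hF : Irreducible F) {G : MvPolynomial (Fin 2) ℝ} (hG : G ≠ 0 → ¬ F ∣ G) :
    (badX F G).Finite ∧ (badX F G).ncard ≤ (F.totalDegree + G.totalDegree) ^ 4 := by
  unfold badX
  split_ifs with h
  · simp
  · obtain ⟨hfin, hcard⟩ := mv_commonZeros_finite_ncard_le hF (hG h)
    exact ⟨hfin.image _, (Set.ncard_image_le hfin).trans hcard⟩

/-- Off `badX F G`, `G` does not vanish at the zeros of `F`. [folklore] -/
theorem eval_ne_zero_of_not_mem_badX {G : MvPolynomial (Fin 2) ℝ} {x y : ℝ} (hx : x ∉ badX F G)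
    (hG : G ≠ 0) (h0 : MvPolynomial.eval ![x, y] F = 0) : MvPolynomial.eval ![x, y] G ≠ 0 := by
  intro hG0
  apply hx
  unfold badX
  rw [if_neg hG]
  exact ⟨(x, y), ⟨h0, hG0⟩, rfl⟩

variable (F) in
/-- The **bad abscissae** of `F`: roots of the leading coefficient of `F ∈ ℝ[x][y]`, and
`x`-coordinates of the zeros of `F` at which `∂F/∂y = 0` or the slope `-F_x/F_y` is `±1`.
[folklore] -/
noncomputable def badSet : Set ℝ :=
  (↑((toY F).leadingCoeff.roots.toFinset) : Set ℝ) ∪ badX F (pderiv 1 F) ∪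
    (badX F (pderiv 0 F + pderiv 1 F) ∪ badX F (pderiv 0 F - pderiv 1 F))

/-- Degree bookkeeping for the partial derivatives. [folklore] -/
theorem totalDegree_pderiv_le (i : Fin 2) : (pderiv i F).totalDegree ≤ F.totalDegree := by
  by_cases h : pderiv i F = 0
  · rw [h, totalDegree_zero]; exact Nat.zero_le _
  · exact (totalDegree_pderiv_lt F h).le

/-- `F` does not divide its nonzero partial derivatives. [folklore] -/
theorem not_dvd_pderiv {i : Fin 2} (h : pderiv i F ≠ 0) : ¬ F ∣ pderiv i F :=
  not_dvd_of_totalDegree_lt h (totalDegree_pderiv_lt F h)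

/-- `deg (F_x + F_y) ≤ deg F`. [folklore] -/
theorem totalDegree_Qplus_le : (pderiv 0 F + pderiv 1 F).totalDegree ≤ F.totalDegree :=
  (totalDegree_add _ _).trans (max_le (totalDegree_pderiv_le 0) (totalDegree_pderiv_le 1))

/-- `deg (F_x - F_y) ≤ deg F`. [folklore] -/
theorem totalDegree_Qminus_le : (pderiv 0 F - pderiv 1 F).totalDegree ≤ F.totalDegree :=
  (totalDegree_sub _ _).trans (max_le (totalDegree_pderiv_le 0) (totalDegree_pderiv_le 1))

/-- `F` does not divide `F_x + F_y` when the latter is nonzero. [folklore] -/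
theorem not_dvd_Qplus (hd : 1 ≤ F.totalDegree) (h : pderiv 0 F + pderiv 1 F ≠ 0) :
    ¬ F ∣ pderiv 0 F + pderiv 1 F := by
  refine not_dvd_of_totalDegree_lt h ((totalDegree_add _ _).trans_lt (max_lt ?_ ?_))
  · by_cases h0 : pderiv 0 F = 0
    · rw [h0, totalDegree_zero]; omega
    · exact totalDegree_pderiv_lt F h0
  · by_cases h1 : pderiv 1 F = 0
    · rw [h1, totalDegree_zero]; omega
    · exact totalDegree_pderiv_lt F h1

/-- `F` does not divide `F_x - F_y` when the latter is nonzero. [folklore] -/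
theorem not_dvd_Qminus (hd : 1 ≤ F.totalDegree) (h : pderiv 0 F - pderiv 1 F ≠ 0) :
    ¬ F ∣ pderiv 0 F - pderiv 1 F := by
  refine not_dvd_of_totalDegree_lt h ((totalDegree_sub _ _).trans_lt (max_lt ?_ ?_))
  · by_cases h0 : pderiv 0 F = 0
    · rw [h0, totalDegree_zero]; omega
    · exact totalDegree_pderiv_lt F h0
  · by_cases h1 : pderiv 1 F = 0
    · rw [h1, totalDegree_zero]; omega
    · exact totalDegree_pderiv_lt F h1

/-- The bad set is finite, of size `≤ d + 3 (2d)⁴`. [folklore] -/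
theorem badSet_finite (hF : Irreducible F) (hd : 2 ≤ F.totalDegree) :
    (badSet F).Finite ∧ (badSet F).ncard ≤ F.totalDegree + 3 * (2 * F.totalDegree) ^ 4 := by
  set d := F.totalDegree with hddef
  obtain ⟨f1, c1⟩ := badX_finite hF (G := pderiv 1 F) fun h => not_dvd_pderiv h
  obtain ⟨f2, c2⟩ := badX_finite hF (G := pderiv 0 F + pderiv 1 F) fun h =>
    not_dvd_Qplus (by omega) h
  obtain ⟨f3, c3⟩ := badX_finite hF (G := pderiv 0 F - pderiv 1 F) fun h =>
    not_dvd_Qminus (by omega) h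
  have f0 : (↑((toY F).leadingCoeff.roots.toFinset) : Set ℝ).Finite := Finset.finite_toSet _
  have c0 : (↑((toY F).leadingCoeff.roots.toFinset) : Set ℝ).ncard ≤ d := by
    rw [Set.ncard_coe_finset]
    calc (toY F).leadingCoeff.roots.toFinset.card ≤ (toY F).leadingCoeff.natDegree :=
          (Multiset.toFinset_card_le _).trans (card_roots' _)
      _ ≤ d := natDegree_coeff_symm_le F _
  have hb : ∀ {G : MvPolynomial (Fin 2) ℝ}, G.totalDegree ≤ d →
      (d + G.totalDegree) ^ 4 ≤ (2 * d) ^ 4 := fun h =>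
    Nat.pow_le_pow_left (by omega) 4
  refine ⟨(f0.union f1).union (f2.union f3), ?_⟩
  calc (badSet F).ncard ≤ (↑((toY F).leadingCoeff.roots.toFinset) ∪ badX F (pderiv 1 F)).ncard +
        (badX F (pderiv 0 F + pderiv 1 F) ∪ badX F (pderiv 0 F - pderiv 1 F)).ncard :=
        Set.ncard_union_le _ _
    _ ≤ ((↑((toY F).leadingCoeff.roots.toFinset) : Set ℝ).ncard + (badX F (pderiv 1 F)).ncard) +
        ((badX F (pderiv 0 F + pderiv 1 F)).ncard + (badX F (pderiv 0 F - pderiv 1 F)).ncard) :=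
        add_le_add (Set.ncard_union_le _ _) (Set.ncard_union_le _ _)
    _ ≤ (d + (2 * d) ^ 4) + ((2 * d) ^ 4 + (2 * d) ^ 4) :=
        add_le_add (add_le_add c0 (c1.trans (hb (totalDegree_pderiv_le 1))))
          (add_le_add (c2.trans (hb totalDegree_Qplus_le)) (c3.trans (hb totalDegree_Qminus_le)))
    _ = d + 3 * (2 * d) ^ 4 := by ring

/-- Off the bad set the zeros of `F(x, ·)` are simple. [folklore] -/
theorem simple_of_not_mem_badSet (hF : Irreducible F) (hd : 2 ≤ F.totalDegree) {x y : ℝ}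
    (hx : x ∉ badSet F) (h0 : MvPolynomial.eval ![x, y] F = 0) :
    MvPolynomial.eval ![x, y] (pderiv 1 F) ≠ 0 := by
  by_cases h1 : pderiv 1 F = 0
  · exact absurd h0 (eval_ne_zero_of_pderiv_eq_zero hF hd h1 x y)
  · refine eval_ne_zero_of_not_mem_badX (fun h => hx ?_) h1 h0
    exact Or.inl (Or.inr h)

/-- Off the bad set, `F_x + F_y ≠ 0` at the zeros (unless `F_x + F_y = 0` identically).
[folklore] -/
theorem Qplus_ne_zero_of_not_mem_badSet {x y : ℝ} (hx : x ∉ badSet F)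
    (hQ : pderiv 0 F + pderiv 1 F ≠ 0) (h0 : MvPolynomial.eval ![x, y] F = 0) :
    MvPolynomial.eval ![x, y] (pderiv 0 F + pderiv 1 F) ≠ 0 :=
  eval_ne_zero_of_not_mem_badX (fun h => hx (Or.inr (Or.inl h))) hQ h0

/-- Off the bad set, `F_x - F_y ≠ 0` at the zeros (unless `F_x - F_y = 0` identically).
[folklore] -/
theorem Qminus_ne_zero_of_not_mem_badSet {x y : ℝ} (hx : x ∉ badSet F)
    (hQ : pderiv 0 F - pderiv 1 F ≠ 0) (h0 : MvPolynomial.eval ![x, y] F = 0) :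
    MvPolynomial.eval ![x, y] (pderiv 0 F - pderiv 1 F) ≠ 0 :=
  eval_ne_zero_of_not_mem_badX (fun h => hx (Or.inr (Or.inr h))) hQ h0

/-- Off the bad set the zeros of nearby fibres are uniformly bounded. [folklore] -/
theorem bound_of_not_mem_badSet (hF : Irreducible F) {x₀ : ℝ} (hx : x₀ ∉ badSet F) :
    ∃ R : ℝ, ∀ᶠ x in 𝓝 x₀, ∀ y, MvPolynomial.eval ![x, y] F = 0 → |y| ≤ R := by
  have hlc : (toY F).leadingCoeff ≠ 0 := by
    rw [Ne, leadingCoeff_eq_zero]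
    exact (EmbeddingLike.map_ne_zero_iff (f := (equivMvPolynomial ℝ).symm)).2 hF.ne_zero
  have ha : (toY F).leadingCoeff.eval x₀ ≠ 0 := by
    intro h
    apply hx
    refine Or.inl (Or.inl ?_)
    rw [Finset.mem_coe, Multiset.mem_toFinset, mem_roots hlc]
    exact h
  obtain ⟨R, hR⟩ := fibre_root_bound (toY F) ha
  refine ⟨R, ?_⟩
  filter_upwards [hR] with x hx y hy
  exact hx y (by rwa [← eval_eq_evalEval])

end BadSet

/-! ### Pieces over the `x`-axis -/

section Pieces

variable {F : MvPolynomial (Fin 2) ℝ}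

/-- **Slope behaviour of a branch over a good interval.** Either the branch has slope `≤ 1`
in absolute value throughout, or `|F_y| < |F_x|` along it throughout (slope `> 1`): by
implicit differentiation `F_x + Y' F_y = 0`, the slope is never `±1` off the bad set (or is
identically `±1`), and the slope dichotomy applies. [folklore] -/
theorem branch_slope (hF : Irreducible F) (hd : 2 ≤ F.totalDegree) {a b : ℝ} {Y : ℝ → ℝ}
    (hgood : ∀ x ∈ Set.Ioo a b, x ∉ badSet F) (hY : ContDiffOn ℝ ∞ Y (Set.Ioo a b))
    (hz : ∀ x ∈ Set.Ioo a b, MvPolynomial.eval ![x, Y x] F = 0) :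
    (∀ x ∈ Set.Ioo a b, |deriv Y x| ≤ 1) ∨
      (∀ x ∈ Set.Ioo a b, |MvPolynomial.eval ![x, Y x] (pderiv 1 F)| <
        |MvPolynomial.eval ![x, Y x] (pderiv 0 F)|) := by
  have hdiff : ∀ x ∈ Set.Ioo a b, MvPolynomial.eval ![x, Y x] (pderiv 0 F) +
      deriv Y x * MvPolynomial.eval ![x, Y x] (pderiv 1 F) = 0 := by
    intro x hx
    have hYd : DifferentiableAt ℝ Y x :=
      (hY.differentiableOn (by simp)).differentiableAt (Ioo_mem_nhds hx.1 hx.2)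
    refine pderiv_add_deriv_mul_pderiv_eq_zero F hYd.hasDerivAt ?_
    filter_upwards [Ioo_mem_nhds hx.1 hx.2] with t ht
    exact hz t ht
  have hFy : ∀ x ∈ Set.Ioo a b, MvPolynomial.eval ![x, Y x] (pderiv 1 F) ≠ 0 :=
    fun x hx => simple_of_not_mem_badSet hF hd (hgood x hx) (hz x hx)
  by_cases hQp : pderiv 0 F + pderiv 1 F = 0
  · left
    intro x hx
    have h1 := hdiff x hx
    have h2 : MvPolynomial.eval ![x, Y x] (pderiv 0 F) =
        -MvPolynomial.eval ![x, Y x] (pderiv 1 F) := by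
      have := congrArg (MvPolynomial.eval ![x, Y x]) hQp
      rw [map_add, map_zero] at this
      linarith
    have h3 : (deriv Y x - 1) * MvPolynomial.eval ![x, Y x] (pderiv 1 F) = 0 := by
      rw [h2] at h1
      linarith
    rcases mul_eq_zero.1 h3 with h | h
    · rw [show deriv Y x = 1 by linarith, abs_one]
    · exact absurd h (hFy x hx)
  by_cases hQm : pderiv 0 F - pderiv 1 F = 0
  · left
    intro x hx
    have h1 := hdiff x hx
    have h2 : MvPolynomial.eval ![x, Y x] (pderiv 0 F) =
        MvPolynomial.eval ![x, Y x] (pderiv 1 F) := by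
      have := congrArg (MvPolynomial.eval ![x, Y x]) hQm
      rw [map_sub, map_zero] at this
      linarith
    have h3 : (deriv Y x + 1) * MvPolynomial.eval ![x, Y x] (pderiv 1 F) = 0 := by
      rw [h2] at h1
      linarith
    rcases mul_eq_zero.1 h3 with h | h
    · rw [show deriv Y x = -1 by linarith, abs_neg, abs_one]
    · exact absurd h (hFy x hx)
  have hne1 : ∀ x ∈ Set.Ioo a b, deriv Y x ≠ 1 := by
    intro x hx h
    have h1 := hdiff x hx
    rw [h, one_mul] at h1
    exact Qplus_ne_zero_of_not_mem_badSet (hgood x hx) hQp (hz x hx) (by rwa [map_add])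
  have hne2 : ∀ x ∈ Set.Ioo a b, deriv Y x ≠ -1 := by
    intro x hx h
    have h1 := hdiff x hx
    rw [h] at h1
    exact Qminus_ne_zero_of_not_mem_badSet (hgood x hx) hQm (hz x hx)
      (by rw [map_sub]; linarith)
  rcases slope_dichotomy hY hne1 hne2 with h | h
  · exact Or.inl h
  · right
    intro x hx
    have h1 := hdiff x hx
    have hgt := h x hx
    have h2 : MvPolynomial.eval ![x, Y x] (pderiv 0 F) =
        -(deriv Y x * MvPolynomial.eval ![x, Y x] (pderiv 1 F)) := by linarith
    rw [h2, abs_neg, abs_mul]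
    have hpos : 0 < |MvPolynomial.eval ![x, Y x] (pderiv 1 F)| := abs_pos.2 (hFy x hx)
    nlinarith

/-- The number of branches over a good interval is at most `deg F`. [folklore] -/
theorem card_branches_le (hF : Irreducible F) (hd : 2 ≤ F.totalDegree) {a b : ℝ} (hab : a < b)
    {r : ℕ} {Y : Fin r → ℝ → ℝ} (hm : ∀ x ∈ Set.Ioo a b, StrictMono fun i => Y i x)
    (hz : ∀ x ∈ Set.Ioo a b, ∀ y, MvPolynomial.eval ![x, y] F = 0 ↔ ∃ i, Y i x = y) :
    r ≤ F.totalDegree := by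
  classical
  have hx : (a + b) / 2 ∈ Set.Ioo a b := ⟨by linarith, by linarith⟩
  set x := (a + b) / 2
  obtain ⟨hfin, hcard⟩ := fibre_finite hF hd x
  have hsub : (↑(Finset.univ.image fun i => Y i x) : Set ℝ) ⊆
      {y | MvPolynomial.eval ![x, y] F = 0} := by
    intro y hy
    rw [Finset.coe_image, Set.mem_image] at hy
    obtain ⟨i, -, rfl⟩ := hy
    exact (hz x hx _).2 ⟨i, rfl⟩
  calc r = (Finset.univ.image fun i => Y i x).card := by
        rw [Finset.card_image_of_injective _ (hm x hx).injective, Finset.card_univ,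
          Fintype.card_fin]
    _ = (↑(Finset.univ.image fun i => Y i x) : Set ℝ).ncard := (Set.ncard_coe_finset _).symm
    _ ≤ {y | MvPolynomial.eval ![x, y] F = 0}.ncard := Set.ncard_le_ncard hsub hfin
    _ ≤ F.totalDegree := hcard

/-- **Pieces over the `x`-axis.** For `F` irreducible of degree `d ≥ 2` and `N ≥ 1` there are a
finite set `B` of bad abscissae (`#B ≤ d + 3(2d)⁴`) and a finite set `P` of pieces
`(a, b, Y)` — smooth functions `Y` on `(a, b)`, `b - a ≤ 4N`, of slope `≤ 1`, with
`F(x, Y x) = 0` — with `#P ≤ (d + 3(2d)⁴ + 2)² d`, such that every zero `(x, y)` of `F` with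
`x ∉ B`, `|x| < N + 1` either lies on a piece or satisfies `|F_y(x, y)| < |F_x(x, y)|`; moreover
`F_y ≠ 0` at every zero with `x ∉ B`. [folklore] -/
theorem xPieces (hF : Irreducible F) (hd : 2 ≤ F.totalDegree) {N : ℝ} (hN : 1 ≤ N) :
    ∃ (B : Finset ℝ) (P : Finset (ℝ × ℝ × (ℝ → ℝ))),
      B.card ≤ F.totalDegree + 3 * (2 * F.totalDegree) ^ 4 ∧
      P.card ≤ (F.totalDegree + 3 * (2 * F.totalDegree) ^ 4 + 2) ^ 2 * F.totalDegree ∧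
      (∀ p ∈ P, p.1 < p.2.1 ∧ p.2.1 - p.1 ≤ 4 * N ∧ ContDiffOn ℝ ∞ p.2.2 (Set.Ioo p.1 p.2.1) ∧
        (∀ x ∈ Set.Ioo p.1 p.2.1, |deriv p.2.2 x| ≤ 1) ∧
        (∀ x ∈ Set.Ioo p.1 p.2.1, MvPolynomial.eval ![x, p.2.2 x] F = 0)) ∧
      (∀ x y, MvPolynomial.eval ![x, y] F = 0 → x ∉ B →
        MvPolynomial.eval ![x, y] (pderiv 1 F) ≠ 0) ∧
      (∀ x y, MvPolynomial.eval ![x, y] F = 0 → x ∉ B → |x| < N + 1 →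
        (∃ p ∈ P, x ∈ Set.Ioo p.1 p.2.1 ∧ p.2.2 x = y) ∨
          |MvPolynomial.eval ![x, y] (pderiv 1 F)| < |MvPolynomial.eval ![x, y] (pderiv 0 F)|) := by
  classical
  obtain ⟨hBfin, hBcard⟩ := badSet_finite hF hd
  set B := hBfin.toFinset with hBdef
  have hBmem : ∀ x, x ∈ B ↔ x ∈ badSet F := fun x => Set.Finite.mem_toFinset hBfin
  set T : Finset ℝ := insert (-(N + 1)) (insert (N + 1) (B.filter fun z => |z| ≤ N + 1))
    with hTdef
  have hTabs : ∀ z ∈ T, |z| ≤ N + 1 := by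
    intro z hz
    simp only [hTdef, Finset.mem_insert, Finset.mem_filter] at hz
    rcases hz with rfl | rfl | ⟨-, h⟩
    · rw [abs_neg, abs_of_nonneg (by linarith)]
    · rw [abs_of_nonneg (by linarith)]
    · exact h
  have hTcard : T.card ≤ B.card + 2 := by
    calc T.card ≤ (insert (N + 1) (B.filter fun z => |z| ≤ N + 1)).card + 1 :=
          Finset.card_insert_le _ _
      _ ≤ (B.filter fun z => |z| ≤ N + 1).card + 1 + 1 := by
          gcongr; exact Finset.card_insert_le _ _
      _ ≤ B.card + 2 := by
          have := Finset.card_filter_le B (fun z => |z| ≤ N + 1); omega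
  set GP : Finset (ℝ × ℝ) :=
    (T ×ˢ T).filter fun pq => pq.1 < pq.2 ∧ ∀ z ∈ B, z ∉ Set.Ioo pq.1 pq.2 with hGPdef
  have hGPgood : ∀ pq ∈ GP, pq.1 < pq.2 ∧ ∀ x ∈ Set.Ioo pq.1 pq.2, x ∉ badSet F := by
    intro pq hpq
    obtain ⟨-, hlt, hgood⟩ := Finset.mem_filter.1 hpq
    exact ⟨hlt, fun x hx hxB => hgood x ((hBmem x).2 hxB) hx⟩
  -- branches over each good pair
  have hgb : ∀ pq : GP, ∃ (r : ℕ) (Y : Fin r → ℝ → ℝ), r ≤ F.totalDegree ∧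
      (∀ i, ContDiffOn ℝ ∞ (Y i) (Set.Ioo pq.1.1 pq.1.2)) ∧
      (∀ x ∈ Set.Ioo pq.1.1 pq.1.2, StrictMono fun i => Y i x) ∧
      (∀ x ∈ Set.Ioo pq.1.1 pq.1.2, ∀ y, MvPolynomial.eval ![x, y] F = 0 ↔ ∃ i, Y i x = y) := by
    intro pq
    obtain ⟨hlt, hnotB⟩ := hGPgood pq.1 pq.2
    obtain ⟨r, Y, hs, hm, hz⟩ := global_branches F hlt (fun x _ => (fibre_finite hF hd x).1)
      (fun x hx y hy => simple_of_not_mem_badSet hF hd (hnotB x hx) hy)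
      (fun x hx => bound_of_not_mem_badSet hF (hnotB x hx))
    exact ⟨r, Y, card_branches_le hF hd hlt hm hz, hs, hm, hz⟩
  choose r Y hr hYs hYm hYz using hgb
  -- the pieces
  set P : Finset (ℝ × ℝ × (ℝ → ℝ)) := Finset.univ.biUnion fun pq : GP =>
    ((Finset.univ : Finset (Fin (r pq))).filter fun i =>
      ∀ x ∈ Set.Ioo pq.1.1 pq.1.2, |deriv (Y pq i) x| ≤ 1).image
        fun i => (pq.1.1, pq.1.2, Y pq i) with hPdef
  refine ⟨B, P, ?_, ?_, ?_, ?_, ?_⟩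
  · -- `#B`
    rwa [hBdef, ← Set.ncard_eq_toFinset_card _ hBfin]
  · -- `#P`
    calc P.card ≤ ∑ pq : GP, (((Finset.univ : Finset (Fin (r pq))).filter fun i =>
          ∀ x ∈ Set.Ioo pq.1.1 pq.1.2, |deriv (Y pq i) x| ≤ 1).image
            fun i => (pq.1.1, pq.1.2, Y pq i)).card := Finset.card_biUnion_le
      _ ≤ ∑ _pq : GP, F.totalDegree := by
          refine Finset.sum_le_sum fun pq _ => ?_
          refine Finset.card_image_le.trans ((Finset.card_filter_le _ _).trans ?_)
          rw [Finset.card_univ, Fintype.card_fin]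
          exact hr pq
      _ = GP.card * F.totalDegree := by simp
      _ ≤ (T.card * T.card) * F.totalDegree := by
          gcongr
          rw [← Finset.card_product]
          exact Finset.card_filter_le _ _
      _ ≤ (F.totalDegree + 3 * (2 * F.totalDegree) ^ 4 + 2) ^ 2 * F.totalDegree := by
          have hB' : B.card ≤ F.totalDegree + 3 * (2 * F.totalDegree) ^ 4 := by
            rwa [hBdef, ← Set.ncard_eq_toFinset_card _ hBfin]
          have hT' : T.card ≤ F.totalDegree + 3 * (2 * F.totalDegree) ^ 4 + 2 := by omega
          gcongr ?_ * _
          rw [sq]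
          exact Nat.mul_le_mul hT' hT'
  · -- the pieces are smooth branches of slope `≤ 1`
    intro p hp
    simp only [hPdef, Finset.mem_biUnion, Finset.mem_univ, true_and, Finset.mem_image,
      Finset.mem_filter] at hp
    obtain ⟨pq, i, hslope, rfl⟩ := hp
    obtain ⟨hlt, -⟩ := hGPgood pq.1 pq.2
    have hmemT : pq.1.1 ∈ T ∧ pq.1.2 ∈ T := by
      have := (Finset.mem_filter.1 pq.2).1
      exact Finset.mem_product.1 this
    refine ⟨hlt, ?_, hYs pq i, hslope, fun x hx => (hYz pq x hx _).2 ⟨i, rfl⟩⟩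
    have h1 := hTabs _ hmemT.1
    have h2 := hTabs _ hmemT.2
    rw [abs_le] at h1 h2
    linarith
  · -- simple zeros off `B`
    intro x y h0 hx
    exact simple_of_not_mem_badSet hF hd (fun h => hx ((hBmem x).2 h)) h0
  · -- covering
    intro x y h0 hxB hxN
    have hxbad : x ∉ badSet F := fun h => hxB ((hBmem x).2 h)
    -- the good pair around `x`
    have hlo : (-(N + 1)) ∈ T.filter (· < x) := by
      refine Finset.mem_filter.2 ⟨by simp [hTdef], ?_⟩
      have := (abs_lt.1 hxN).1; linarith
    have hhi : (N + 1) ∈ T.filter (x < ·) := by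
      refine Finset.mem_filter.2 ⟨by simp [hTdef], (abs_lt.1 hxN).2⟩
    set p₀ := (T.filter (· < x)).max' ⟨_, hlo⟩ with hp₀def
    set q₀ := (T.filter (x < ·)).min' ⟨_, hhi⟩ with hq₀def
    have hp₀ : p₀ ∈ T ∧ p₀ < x := by
      have := Finset.max'_mem (T.filter (· < x)) ⟨_, hlo⟩
      exact Finset.mem_filter.1 this
    have hq₀ : q₀ ∈ T ∧ x < q₀ := by
      have := Finset.min'_mem (T.filter (x < ·)) ⟨_, hhi⟩
      exact Finset.mem_filter.1 this
    have hmem : (p₀, q₀) ∈ GP := by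
      refine Finset.mem_filter.2 ⟨Finset.mem_product.2 ⟨hp₀.1, hq₀.1⟩, hp₀.2.trans hq₀.2, ?_⟩
      intro z hz hzI
      have hzT : z ∈ T := by
        have h1 := hTabs _ hp₀.1
        have h2 := hTabs _ hq₀.1
        rw [abs_le] at h1 h2
        simp only [hTdef, Finset.mem_insert, Finset.mem_filter]
        refine Or.inr (Or.inr ⟨hz, ?_⟩)
        rw [abs_le]
        exact ⟨by linarith [hzI.1], by linarith [hzI.2]⟩
      rcases lt_trichotomy z x with hzx | rfl | hxz
      · have : z ≤ p₀ := Finset.le_max' _ z (Finset.mem_filter.2 ⟨hzT, hzx⟩)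
        linarith [hzI.1]
      · exact hxB hz
      · have : q₀ ≤ z := Finset.min'_le _ z (Finset.mem_filter.2 ⟨hzT, hxz⟩)
        linarith [hzI.2]
    set pq : GP := ⟨(p₀, q₀), hmem⟩ with hpqdef
    have hxI : x ∈ Set.Ioo p₀ q₀ := ⟨hp₀.2, hq₀.2⟩
    obtain ⟨i, hi⟩ := (hYz pq x hxI y).1 h0
    obtain ⟨-, hnotB⟩ := hGPgood _ hmem
    rcases branch_slope hF hd hnotB (hYs pq i) (fun x' hx' => (hYz pq x' hx' _).2 ⟨i, rfl⟩)
      with hsl | hsl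
    · left
      refine ⟨(p₀, q₀, Y pq i), ?_, hxI, hi⟩
      simp only [hPdef, Finset.mem_biUnion, Finset.mem_univ, true_and, Finset.mem_image,
        Finset.mem_filter]
      exact ⟨pq, i, hsl, rfl⟩
    · right
      have := hsl x hxI
      rwa [hi] at this

end Pieces

/-! ### The branch decomposition -/

section Main

/-- Fibres in `x` of the curve, via the swapped polynomial. [folklore] -/
theorem fibre_finite_swap {F : MvPolynomial (Fin 2) ℝ}
    (hF : Irreducible (rename (Equiv.swap (0 : Fin 2) 1) F))
    (hd : 2 ≤ (rename (Equiv.swap (0 : Fin 2) 1) F).totalDegree) (y : ℝ) :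
    {x | MvPolynomial.eval ![x, y] F = 0}.Finite ∧
      {x | MvPolynomial.eval ![x, y] F = 0}.ncard ≤
        (rename (Equiv.swap (0 : Fin 2) 1) F).totalDegree := by
  have := fibre_finite hF hd y
  simp only [eval_swap] at this
  exact this

/-- **The branch decomposition of a real plane curve** (Bombieri–Pila 1989, proof of
Theorem 5): proof of the named fact `bombieriPila_curve_subset_branches`, with
`c(d) = 2βd + 2(β + 2)²d`, `β = d + 3(2d)⁴`. The pieces over the `x`-axis come from `xPieces`
applied to `F`, those over the `y`-axis from `xPieces` applied to `F` with its variables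
swapped; a zero on no piece would have both `|F_y| < |F_x|` and `|F_x| < |F_y|`. The
exceptional set consists of the (finite) fibres over the two bad sets.
[cite: BombieriPila1989, proof of Theorem 5] -/
theorem bombieriPila_curve_subset_branches_holds : bombieriPila_curve_subset_branches := by
  intro d hd
  refine ⟨2 * (d + 3 * (2 * d) ^ 4) * d + 2 * ((d + 3 * (2 * d) ^ 4 + 2) ^ 2 * d), ?_⟩
  intro F hFd hFirr N hN
  classical
  have hF : Irreducible F := irreducible_of_irreducible_map_complex hFirr
  have hd2 : 2 ≤ F.totalDegree := hFd ▸ hd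
  set Fs := rename (Equiv.swap (0 : Fin 2) 1) F with hFsdef
  have hFs : Irreducible Fs := irreducible_of_irreducible_map_complex (irreducible_map_swap hFirr)
  have hFsd : Fs.totalDegree = d := (totalDegree_swap F).trans hFd
  have hd2s : 2 ≤ Fs.totalDegree := hFsd ▸ hd
  obtain ⟨B₁, P₁, hB₁, hP₁, hpc₁, -, hcov₁⟩ := xPieces hF hd2 hN
  obtain ⟨B₂, P₂, hB₂, hP₂, hpc₂, -, hcov₂⟩ := xPieces hFs hd2s hN
  rw [hFd] at hB₁ hP₁
  rw [hFsd] at hB₂ hP₂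
  have hfib₁ := fibre_finite hF hd2
  have hfib₂ := fibre_finite_swap hFs hd2s
  -- the exceptional set
  set E₁ : Finset (ℝ × ℝ) := B₁.biUnion fun x => (hfib₁ x).1.toFinset.image fun y => (x, y)
    with hE₁
  set E₂ : Finset (ℝ × ℝ) := B₂.biUnion fun y => (hfib₂ y).1.toFinset.image fun x => (x, y)
    with hE₂
  have hE₁card : E₁.card ≤ B₁.card * d := by
    calc E₁.card ≤ ∑ x ∈ B₁, ((hfib₁ x).1.toFinset.image fun y => (x, y)).card :=
          Finset.card_biUnion_le
      _ ≤ ∑ _x ∈ B₁, d := by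
          refine Finset.sum_le_sum fun x _ => Finset.card_image_le.trans ?_
          rw [← Set.ncard_eq_toFinset_card _ (hfib₁ x).1, ← hFd]
          exact (hfib₁ x).2
      _ = B₁.card * d := by simp
  have hE₂card : E₂.card ≤ B₂.card * d := by
    calc E₂.card ≤ ∑ y ∈ B₂, ((hfib₂ y).1.toFinset.image fun x => (x, y)).card :=
          Finset.card_biUnion_le
      _ ≤ ∑ _y ∈ B₂, d := by
          refine Finset.sum_le_sum fun y _ => Finset.card_image_le.trans ?_
          rw [← Set.ncard_eq_toFinset_card _ (hfib₂ y).1, ← hFsd]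
          exact (hfib₂ y).2
      _ = B₂.card * d := by simp
  -- indexing the pieces by `Fin`
  set e₁ := P₁.equivFin with he₁
  set e₂ := P₂.equivFin with he₂
  refine ⟨E₁ ∪ E₂, P₁.card, P₂.card, fun i => (e₁.symm i).1.1, fun i => (e₁.symm i).1.2.1,
    fun i => (e₁.symm i).1.2.2, fun i => (e₂.symm i).1.1, fun i => (e₂.symm i).1.2.1,
    fun i => (e₂.symm i).1.2.2, ?_, ?_, ?_, ?_⟩
  · -- the count
    have hβd : B₁.card * d ≤ (d + 3 * (2 * d) ^ 4) * d := Nat.mul_le_mul_right _ hB₁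
    have hβd' : B₂.card * d ≤ (d + 3 * (2 * d) ^ 4) * d := Nat.mul_le_mul_right _ hB₂
    have := Finset.card_union_le E₁ E₂
    have hassoc : 2 * (d + 3 * (2 * d) ^ 4) * d = 2 * ((d + 3 * (2 * d) ^ 4) * d) := by ring
    rw [hassoc]
    omega
  · intro i
    obtain ⟨hlt, hlen, hs, hsl, hz⟩ := hpc₁ _ (e₁.symm i).2
    exact ⟨hlen, ⟨hlt, hs, hsl, hz⟩⟩
  · intro i
    obtain ⟨hlt, hlen, hs, hsl, hz⟩ := hpc₂ _ (e₂.symm i).2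
    exact ⟨hlen, ⟨hlt, hs, hsl, hz⟩⟩
  · -- the covering
    intro x y hx hy h0
    by_cases hxB : x ∈ B₁
    · left
      refine Finset.mem_union_left _ (Finset.mem_biUnion.2 ⟨x, hxB, ?_⟩)
      exact Finset.mem_image.2 ⟨y, (hfib₁ x).1.mem_toFinset.2 h0, rfl⟩
    by_cases hyB : y ∈ B₂
    · left
      refine Finset.mem_union_right _ (Finset.mem_biUnion.2 ⟨y, hyB, ?_⟩)
      exact Finset.mem_image.2 ⟨x, (hfib₂ y).1.mem_toFinset.2 h0, rfl⟩
    right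
    have h0s : MvPolynomial.eval ![y, x] Fs = 0 := by rw [hFsdef, eval_swap]; exact h0
    have hxN : |x| < N + 1 := by linarith
    have hyN : |y| < N + 1 := by linarith
    rcases hcov₁ x y h0 hxB hxN with ⟨p, hp, hxI, hpx⟩ | hlt₁
    · left
      refine ⟨e₁ ⟨p, hp⟩, ?_⟩
      simp only [Equiv.symm_apply_apply]
      exact ⟨hxI, hpx⟩
    rcases hcov₂ y x h0s hyB hyN with ⟨p, hp, hyI, hpy⟩ | hlt₂
    · right
      refine ⟨e₂ ⟨p, hp⟩, ?_⟩
      simp only [Equiv.symm_apply_apply]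
      exact ⟨hyI, hpy⟩
    exfalso
    rw [hFsdef, pderiv_rename_swap, pderiv_rename_swap, eval_swap, eval_swap] at hlt₂
    simp only [Equiv.swap_apply_right, Equiv.swap_apply_left] at hlt₂
    exact lt_asymm hlt₁ hlt₂

end Main

end Literature.NumberTheory.DiophantineGeometry.Dioph
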